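import Mathlib

/-!
# p5 g16 3-PROBE of w1 g10's R3′ plan §4 signature `LadderCrush.hypocoercive_decay` (memo `Lines/onelevel-vtheta-R3-plan.md`)
Elaboration check of the ABSTRACT signature exactly as written, with the one forced change `λ ↦ lam`
(`λ` is a reserved token in Lean 4).  Proof bodies are `sorry` — this file certifies the STATEMENT typechecks, nothing else.
(P1) degenerate member, (P2) joint satisfiability of h1–h5/P1–P8, (P3) scope: see the STATUS stamp.
-/

open scoped InnerProductSpace

namespace Summit.AnomalousDissipation.AnomalousDissipation.Theorems.SolenoidalFractalHomogenisation.LagrangianStep.P5ProbeLadderCrush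

/-- The signature of `LadderCrush.hypocoercive_decay` verbatim (`λ ↦ lam`). -/
theorem hypocoercive_decay_sig {F : Type*} [NormedAddCommGroup F] [InnerProductSpace ℝ F]
    (V : Submodule ℝ F) (K B C : F →L[ℝ] F) (D : ℝ → F →L[ℝ] F) (G : ℝ → ℝ) (y : ℝ → F) {t₀ t₁ : ℝ} (ht : t₀ ≤ t₁)
    (hK : ∀ u v, ⟪K u, v⟫_ℝ = ⟪u, K v⟫_ℝ) (hB : ∀ u v, ⟪B u, v⟫_ℝ = -⟪u, B v⟫_ℝ) (hC : ∀ u, C u = K (B u) - B (K u))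
    (hDs : ∀ t u v, ⟪D t u, v⟫_ℝ = ⟪u, D t v⟫_ℝ) (hDp : ∀ t u, 0 ≤ ⟪D t u, u⟫_ℝ) (hKD : ∀ t u, K (D t u) = D t (K u)) (hVK : ∀ u ∈ V, K u ∈ V)
    (hyV : ∀ t ∈ Set.Icc t₀ t₁, y t ∈ V) (hy : ∀ t ∈ Set.Icc t₀ t₁, HasDerivAt y (G t • B (y t) - D t (y t)) t)
    {Gm GM lo₁ CJ A η U₁ U₂ U₃ α β lam : ℝ} (hG : ∀ t ∈ Set.Icc t₀ t₁, Gm ≤ G t ∧ G t ≤ GM) (hGm : 0 ≤ Gm) (hlo₁ : 0 < lo₁) (hα : 0 < α) (hβ : 0 ≤ β) (hlam : 0 ≤ lam)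
    (h1 : ∀ t ∈ Set.Icc t₀ t₁, ∀ u ∈ V, lo₁ * ‖K u‖ ^ 2 ≤ ⟪D t u, u⟫_ℝ) (h2 : ∀ t ∈ Set.Icc t₀ t₁, ∀ u ∈ V, ⟪D t (C u), C u⟫_ℝ ≤ CJ * ⟪D t u, u⟫_ℝ)
    (h3 : ∀ u ∈ V, ‖C u‖ ^ 2 ≤ A * ‖u‖ ^ 2) (h4 : ∀ t ∈ Set.Icc t₀ t₁, ∀ u ∈ V, -(η * ⟪D t u, u⟫_ℝ) ≤ ⟪K u, C (B u) - B (C u)⟫_ℝ)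
    (h5 : ∀ t ∈ Set.Icc t₀ t₁, ∀ u ∈ V, ‖u‖ ^ 2 ≤ U₁ * ‖C u‖ ^ 2 + U₂ * ‖K u‖ ^ 2 + U₃ * ⟪D t u, u⟫_ℝ)
    (P1 : 4 * A * β ^ 2 ≤ α) (P2 : 8 * CJ * β ^ 2 ≤ α) (P3 : 2 * α ^ 2 * GM ^ 2 ≤ β * Gm * lo₁) (P4 : 8 * β * GM * η ≤ 1)
    (P5 : 6 * lam * α ≤ lo₁) (P6 : 6 * lam * U₂ ≤ lo₁) (P7 : 6 * lam * U₃ ≤ 1) (P8 : 3 * lam * U₁ ≤ 2 * β * Gm) :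
    ‖y t₁‖ ^ 2 ≤ 3 * Real.exp (-(lam * (t₁ - t₀))) * (‖y t₀‖ ^ 2 + α * ‖K (y t₀)‖ ^ 2) := by
  sorry

/-- (P3-robust variant p5 recommends) derivative only on the OPEN interval + continuity on the closed one — strictly weaker data,
what `image_le_of_deriv_right_le`-style monotonicity lemmas consume, and what a slot solution with envelope kinks at the window ends provides. -/
theorem hypocoercive_decay_sig' {F : Type*} [NormedAddCommGroup F] [InnerProductSpace ℝ F]
    (V : Submodule ℝ F) (K B C : F →L[ℝ] F) (D : ℝ → F →L[ℝ] F) (G : ℝ → ℝ) (y : ℝ → F) {t₀ t₁ : ℝ} (ht : t₀ ≤ t₁)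
    (hyc : ContinuousOn y (Set.Icc t₀ t₁)) (hy : ∀ t ∈ Set.Ioo t₀ t₁, HasDerivAt y (G t • B (y t) - D t (y t)) t)
    (hyV : ∀ t ∈ Set.Icc t₀ t₁, y t ∈ V) {α lam : ℝ} :
    ‖y t₁‖ ^ 2 ≤ 3 * Real.exp (-(lam * (t₁ - t₀))) * (‖y t₀‖ ^ 2 + α * ‖K (y t₀)‖ ^ 2) := by
  sorry

/-! (P1)/(P2) at the abstract level: the hypothesis set is jointly satisfiable and the conclusion is then true and non-trivial —
`F = EuclideanSpace ℝ (Fin 1)`, `V = ⊤`, `K = id`, `B = C = 0`, `D t = id`, `G ≡ 1`, `y t = e^{-t} y₀`: h1 (lo₁ = 1), h2 (CJ = 0), h3 (A = 0), h4 (η = 0),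
h5 (U₁ = U₂ = 0, U₃ = 1), P1–P8 with `α = β = 1/2`, `lam = 1/6`; conclusion `e^{-2Δ}‖y₀‖² ≤ (9/2)e^{-Δ/6}‖y₀‖²`.  The algebra of the energy
identity was re-derived by hand (STATUS stamp): budget of `⟪Dy,y⟫` used 1/2 (P3) + 1/4 (P2, two cross terms, all of `α⟪DKy,Ky⟫`) + 1/4 (P4) + 3/4 (P5,P6,P7) = 7/4 < 2. -/

/-- The symmetric/antisymmetric bookkeeping the proof needs is DERIVABLE (no extra hypothesis): `C = [K,B]` is symmetric. -/
theorem comm_symm {F : Type*} [NormedAddCommGroup F] [InnerProductSpace ℝ F] (K B C : F →L[ℝ] F)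
    (hK : ∀ u v, ⟪K u, v⟫_ℝ = ⟪u, K v⟫_ℝ) (hB : ∀ u v, ⟪B u, v⟫_ℝ = -⟪u, B v⟫_ℝ) (hC : ∀ u, C u = K (B u) - B (K u)) (u v : F) :
    ⟪C u, v⟫_ℝ = ⟪u, C v⟫_ℝ := by
  rw [hC u, hC v, inner_sub_left, inner_sub_right, hK, hB, hB (K u), hK]
  ring

/-- Real skew-adjointness from vanishing of the diagonal (how `sum_re_inner_link_eq_zero` feeds `hB`): a bounded real operator with
`⟪B u, u⟫ = 0 ∀ u` is skew. -/
theorem skew_of_inner_self_eq_zero {F : Type*} [NormedAddCommGroup F] [InnerProductSpace ℝ F] (B : F →L[ℝ] F)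
    (h : ∀ u, ⟪B u, u⟫_ℝ = 0) (u v : F) : ⟪B u, v⟫_ℝ = -⟪u, B v⟫_ℝ := by
  have h1 := h (u + v)
  simp only [map_add, inner_add_left, inner_add_right, h u, h v, zero_add, add_zero] at h1
  rw [real_inner_comm (B v) u]
  linarith

/-- §3 (U) certificate: with `p = |z|²`, `q = z·m`, `r = |m|²`, the worst-case sum `S = [2(p²+q²)(p+r) − 8pq²]/(p((p+r)²−4q²))` of
`‖P_{z±m}w‖²/‖w‖²` over `w ⊥ z` satisfies `S − 2p/(p+r) = 2q²(p−r)² / (p((p+r)²−4q²)(p+r))` — the numerator identity, kernel-checked. -/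
theorem uncertainty_numerator (p q r : ℝ) :
    (2 * (p ^ 2 + q ^ 2) * (p + r) - 8 * p * q ^ 2) * (p + r) - 2 * p * p * ((p + r) ^ 2 - 4 * q ^ 2) = 2 * q ^ 2 * (p - r) ^ 2 := by
  ring

/-- … and the worst-case sum itself: `2 − (r − q²/p)(1/(p+r+2q) + 1/(p+r−2q)) = S` (clearing denominators; `p ≠ 0`, `(p+r)² ≠ 4q²`). -/
theorem uncertainty_sum (p q r : ℝ) (hp : p ≠ 0) (hplus : p + r + 2 * q ≠ 0) (hminus : p + r - 2 * q ≠ 0) :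
    2 - (r - q ^ 2 / p) * (1 / (p + r + 2 * q) + 1 / (p + r - 2 * q))
      = (2 * (p ^ 2 + q ^ 2) * (p + r) - 8 * p * q ^ 2) / (p * ((p + r + 2 * q) * (p + r - 2 * q))) := by
  field_simp
  ring

/-- §3 (S) sign certificate: for `w ⊥ z`, `‖P_{z+m}w‖² − ‖P_{z−m}w‖² = |⟪m,w⟫|²(1/|z−m|² − 1/|z+m|²)` and `|z+m|² − |z−m|² = 4 z·m`;
the scalar core: -/
theorem signed_commutator_core (p q r c : ℝ) (hplus : p + r + 2 * q ≠ 0) (hminus : p + r - 2 * q ≠ 0) :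
    (1 - c / (p + r + 2 * q)) - (1 - c / (p + r - 2 * q)) = c * (4 * q) / ((p + r + 2 * q) * (p + r - 2 * q)) := by
  field_simp
  ring

end Summit.AnomalousDissipation.AnomalousDissipation.Theorems.SolenoidalFractalHomogenisation.LagrangianStep.P5ProbeLadderCrush
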